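import Summits.RiemannHypothesis.RiemannHypothesis.Theses.RuelleBand
import Summits.RiemannHypothesis.RiemannHypothesis.Theorems.ExactFirstBand.Negative.Reformulations
import Summits.RiemannHypothesis.RiemannHypothesis.Theorems.RuelleBandLadderGlue
import Literature.Barriers.RiemannHypothesis.BohrDenseValuesProofs
import Literature.Barriers.RiemannHypothesis.BohrDenseValuesVoronin
import Literature.NumberTheory.LFunctions.GeneralizedRH
import HarnessLib

/-!
# Crux-strategist sketch for `ExactFirstBand` (stmt-RiemannHypothesis-2061, route RuelleBand)

Companion to `STRATEGY-CENSUS.md` (same crux directory). This file TYPE-CHECKS the statements the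
census quotes under `## Decomposition` (candidate D2) and proves, sorry-free, everything that is
provable about them today:

* `ZetaWeakRecurrence` — weak (Poincaré) recurrence of `ζ` under vertical shifts on every closed
  disc of the open strip `1/2 < σ < 1` ("for every `ε` and every height `T` some shift `τ ≥ T`
  brings `ζ(· + iτ)` within `ε` of `ζ` on the disc");
* `exactFirstBand_of_acl_of_weakRecurrence` — THE GLUE of D2:
  `AsymptoticCriticalLine → ZetaWeakRecurrence → ExactFirstBand` (Rouché step =
  `Literature.Barriers.RiemannHypothesis.exists_zero_near_shift`, Steuding Thm. 8.3 eq. (8.5));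
* `exactFirstBand_iff_acl_and_weakRecurrence` — the split is LOSSLESS (`X ↔ #4 ∧ WR`), using the
  tree's PROVED Voronin universality / Bagchi theorem for `RH → WR`;
* `weakRecurrence_of_zeroFree` — WR holds UNCONDITIONALLY on every zero-free closed disc (Voronin,
  tree `Steuding2007_thm1_9_discAnalytic_holds`): the open content of WR lives exactly on discs
  about hypothetical off-line zeros;
* `zetaStrongRecurrence_iff_riemannHypothesis` — Bagchi's positive-density form is RH itself
  (tree), recorded to show which weakening D2 uses.

Nothing here is registered as a line (see the census for why: both pieces of D2 are open problems
with no supplier). Namespace is the strategist's scratch namespace; no route decl is touched.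
-/

set_option linter.dupNamespace false

noncomputable section

open Complex Set Metric Filter Topology

namespace Summit.RiemannHypothesis.RiemannHypothesis.Cruxes.ExactFirstBand.Strategist

open Summit.RiemannHypothesis.RiemannHypothesis.Theses.RuelleBand
open Literature.Barriers.RiemannHypothesis
open Literature.NumberTheory.LFunctions

/-! ## D2, piece 2: weak shift-recurrence of `ζ` in the open strip -/

/-- WEAK SHIFT RECURRENCE (census D2, the new piece). For every closed disc `|s − z| ≤ r` with
`0 < r < min (Re z − 1/2, 1 − Re z)` (so the disc lies in `1/2 < σ < 1`), every `ε > 0` and every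
height `T`, some shift `τ ≥ T` satisfies `max_{|s−z|≤r} |ζ(s+iτ) − ζ(s)| < ε`.
RH-implied (Voronin 1975 / Bagchi 1981 give positive lower density of such `τ`); unconditional on
zero-free discs (`weakRecurrence_of_zeroFree`); OPEN exactly on discs containing an off-line zero,
where it asserts returns forming a set of lower density ZERO (Bagchi's counting step), about which
every limit theorem of Bohr–Jessen type is silent. [cite: Steuding2007, Thm. 8.3] [cite: Bagchi1987, main theorem] -/
def ZetaWeakRecurrence : Prop :=
  ∀ (z : ℂ) (r : ℝ), 0 < r → r < min (z.re - 1 / 2) (1 - z.re) →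
    ∀ ε : ℝ, 0 < ε → ∀ T : ℝ, ∃ τ : ℝ, T ≤ τ ∧
      ∀ s ∈ closedBall z r, ‖riemannZeta (s + τ * I) - riemannZeta s‖ < ε

/-- Bagchi's STRONG recurrence (positive lower density of the returning shifts) — the hypothesis
of the tree's `riemannHypothesis_of_strongRecurrence`; recorded for comparison: it is RH itself
(`zetaStrongRecurrence_iff_riemannHypothesis`). [cite: Steuding2007, Thm. 8.3] -/
def ZetaStrongRecurrence : Prop :=
  ∀ ε : ℝ, 0 < ε → ∀ z : ℂ, 1 / 2 < z.re → z.re < 1 →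
    ∀ r : ℝ, 0 < r → r < min (z.re - 1 / 2) (1 - z.re) →
      HasPosLowerDensity
        {τ : ℝ | ∀ s ∈ closedBall z r, ‖riemannZeta (s + τ * I) - riemannZeta s‖ < ε}

/-- Bagchi 1981/1987 (Steuding Thm. 8.3 at `θ = 1/2`), from the tree's PROVED Voronin theorem:
strong recurrence ⟺ RH. So the positive-density form is not a decomposition piece but the summit.
[cite: Steuding2007, Thm. 8.3] [cite: Bagchi1987, main theorem] -/
theorem zetaStrongRecurrence_iff_riemannHypothesis : ZetaStrongRecurrence ↔ RiemannHypothesis :=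
  (riemannHypothesis_iff_strongRecurrence_of_Voronin Voronin1975_universality_holds).symm

/-- Strong ⟹ weak (a set of positive lower density is unbounded above). [folklore] -/
theorem zetaWeakRecurrence_of_strong (h : ZetaStrongRecurrence) : ZetaWeakRecurrence := by
  intro z r hr hrmin ε hε T
  have hz1 : 1 / 2 < z.re := by
    have := hrmin.trans_le (min_le_left _ _); linarith
  have hz2 : z.re < 1 := by
    have := hrmin.trans_le (min_le_right _ _); linarith
  obtain ⟨τ, hτ, hTτ⟩ := (h ε hε z hz1 hz2 r hr hrmin).exists_gt T
  exact ⟨τ, hTτ.le, hτ⟩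

/-- CALIBRATION `RH ⟹ WR` (so WR is RH-implied and irrefutable short of `¬RH`).
[cite: Steuding2007, Thm. 8.3 and Thm. 1.7] -/
theorem zetaWeakRecurrence_of_riemannHypothesis (h : RiemannHypothesis) : ZetaWeakRecurrence :=
  zetaWeakRecurrence_of_strong (zetaStrongRecurrence_iff_riemannHypothesis.2 h)

/-- CALIBRATION `X ⟹ WR`. [cite: Steuding2007, Thm. 8.3] -/
theorem zetaWeakRecurrence_of_exactFirstBand (h : ExactFirstBand) : ZetaWeakRecurrence :=
  zetaWeakRecurrence_of_riemannHypothesis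
    (Summit.RiemannHypothesis.Cruxes.ExactFirstBand.Negative.exactFirstBand_iff_riemannHypothesis.1 h)

/-- THE UNCONDITIONAL HALF OF WR (Voronin): on every closed disc of the strip on which `ζ` has no
zero, `ζ` is weakly (indeed strongly) recurrent. Hence WR is open ONLY on discs about off-line
zeros — the regime no value-distribution theorem reaches (the random Euler product is supported on
non-vanishing functions). [cite: Steuding2007, Thm. 1.9] -/
theorem weakRecurrence_of_zeroFree {z : ℂ} {r : ℝ} (hr : 0 < r)
    (hrmin : r < min (z.re - 1 / 2) (1 - z.re))
    (hZ : ∀ s ∈ closedBall z r, riemannZeta s ≠ 0) :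
    ∀ ε : ℝ, 0 < ε → ∀ T : ℝ, ∃ τ : ℝ, T ≤ τ ∧
      ∀ s ∈ closedBall z r, ‖riemannZeta (s + τ * I) - riemannZeta s‖ < ε := by
  intro ε hε T
  have hr1 : r < z.re - 1 / 2 := hrmin.trans_le (min_le_left _ _)
  have hr2 : r < 1 - z.re := hrmin.trans_le (min_le_right _ _)
  set R : ℝ := (r + (1 - z.re)) / 2 with hR
  have hrR : r < R := by rw [hR]; linarith
  have hRlt : z.re + R < 1 := by rw [hR]; linarith
  have hdiff : DifferentiableOn ℂ riemannZeta (ball z R) := by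
    intro s hs
    have hs1 : s ≠ 1 := by
      rintro rfl
      rw [mem_ball, dist_eq_norm] at hs
      have h1 := abs_re_le_norm ((1 : ℂ) - z)
      rw [sub_re, one_re, abs_of_nonneg (by linarith)] at h1
      linarith
    exact (differentiableAt_riemannZeta hs1).differentiableWithinAt
  obtain ⟨δ, hδ, T₀, hT₀⟩ := Steuding2007_thm1_9_discAnalytic_holds z r R hr hrR (by linarith)
    (by linarith) riemannZeta hdiff hZ ε hε
  have hpos : HasPosLowerDensity
      {τ : ℝ | ∀ s ∈ closedBall z r, ‖riemannZeta (s + τ * I) - riemannZeta s‖ < ε} :=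
    ⟨δ, hδ, T₀, hT₀⟩
  obtain ⟨τ, hτ, hTτ⟩ := hpos.exists_gt T
  exact ⟨τ, hTτ.le, hτ⟩

/-! ## D2, the glue: `#4 ∧ WR ⟹ X` (Rouché + "no second band") -/

/-- THE GLUE OF DECOMPOSITION D2 (proved): if only finitely many zeros lie `≥ ε` off the line for
each `ε` (rung #4, `AsymptoticCriticalLine`) and `ζ` is weakly shift-recurrent on every disc of the
strip (`ZetaWeakRecurrence`), then every zero of the open strip is on the critical line (or real —
vacuous), i.e. `ExactFirstBand`. Proof: an off-line zero `ξ` (w.l.o.g. `Re ξ > 1/2`, functional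
equation) is isolated; with `ε = min |ζ|` on a small circle about `ξ`, every late returning shift
`τ` generates by Rouché (`exists_zero_near_shift`) a zero within `δ` of `ξ + iτ`, hence a zero at
distance `≥ (Re ξ − 1/2)/2` from the line and of height `> M`, for every `M` — contradicting the
finiteness in #4. (Bagchi's argument with the density theorem replaced by #4 and positive density
replaced by unboundedly many returns.) [cite: Steuding2007, Thm. 8.3 (proof)] [cite: Bagchi1987, main theorem] -/
theorem exactFirstBand_of_acl_of_weakRecurrence
    (hA : AsymptoticCriticalLine) (hW : ZetaWeakRecurrence) : ExactFirstBand := by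
  intro s hs h0 h1
  by_contra hnot
  push Not at hnot
  obtain ⟨hne, -⟩ := hnot
  -- Step 0: an off-line zero `ξ` in the right half of the open strip
  obtain ⟨ξ, hξ0, hξhalf, hξ1⟩ : ∃ ξ : ℂ, riemannZeta ξ = 0 ∧ 1 / 2 < ξ.re ∧ ξ.re < 1 := by
    rcases lt_or_gt_of_ne hne with hlt | hgt
    · refine ⟨1 - s, GeneralizedRH.riemannZeta_one_sub_eq_zero hs h0 h1, ?_, ?_⟩
      · simp only [sub_re, one_re]; linarith
      · simp only [sub_re, one_re]; linarith
    · exact ⟨s, hs, hgt, h1⟩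
  -- Step 1: rung #4 at `ε₀ = (Re ξ − 1/2)/2` bounds the ordinates of the zeros `≥ ε₀` off the line
  set ε₀ : ℝ := (ξ.re - 1 / 2) / 2 with hε₀
  have hε₀pos : 0 < ε₀ := by rw [hε₀]; linarith
  have hfin := hA ε₀ hε₀pos
  obtain ⟨M, hM⟩ := (hfin.image Complex.im).bddAbove
  -- Step 2: `ξ` is an isolated zero
  have hξne1 : ξ ≠ 1 := by
    intro h; rw [h, one_re] at hξ1; exact lt_irrefl _ hξ1
  have han : AnalyticAt ℂ riemannZeta ξ := analyticOn_riemannZeta ξ hξne1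
  have hev : ∀ᶠ w in 𝓝[≠] ξ, riemannZeta w ≠ 0 := by
    rcases han.eventually_eq_zero_or_eventually_ne_zero with h0' | hne'
    · exfalso
      have h2 : riemannZeta 2 = 0 :=
        analyticOn_riemannZeta.eqOn_zero_of_preconnected_of_eventuallyEq_zero
          (isConnected_compl_singleton_of_one_lt_rank (by simp) (1 : ℂ)).isPreconnected hξne1 h0'
          (show (2 : ℂ) ∈ ({1}ᶜ : Set ℂ) by norm_num)
      exact riemannZeta_ne_zero_of_one_le_re (s := 2) (by norm_num) h2
    · exact hne'
  obtain ⟨δ₁, hδ₁, hpunct⟩ : ∃ δ₁ > 0, ∀ w : ℂ, dist w ξ < δ₁ → w ≠ ξ → riemannZeta w ≠ 0 := by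
    rw [eventually_nhdsWithin_iff, Metric.eventually_nhds_iff] at hev
    obtain ⟨δ₁, hδ₁, h⟩ := hev
    exact ⟨δ₁, hδ₁, fun w hw hne ↦ h hw hne⟩
  -- Step 3: a radius `δ` (inside the punctured disc, inside the strip, and `≤ ε₀`)
  set m : ℝ := min (ξ.re - 1 / 2) (1 - ξ.re) with hmdef
  have hmpos : 0 < m := lt_min (by linarith) (by linarith)
  set δ : ℝ := min (δ₁ / 2) (m / 2) with hδdef
  have hδpos : 0 < δ := lt_min (by linarith) (by linarith)
  have hδ₁' : δ < δ₁ := (min_le_left _ _).trans_lt (by linarith)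
  have hδm : δ < m := (min_le_right _ _).trans_lt (by linarith)
  have hδone : δ < 1 - ξ.re := hδm.trans_le (min_le_right _ _)
  have hδε₀ : δ ≤ ε₀ := by
    have h1 : m ≤ ξ.re - 1 / 2 := min_le_left _ _
    have h2 : δ ≤ m / 2 := min_le_right _ _
    rw [hε₀]; linarith
  -- Step 4: `ε := min_{|w−ξ|=δ} |ζ(w)| > 0`
  have hcont : ContinuousOn (fun w ↦ ‖riemannZeta w‖) (sphere ξ δ) := by
    refine ContinuousOn.norm fun w hw ↦ ?_
    have hw1 : w ≠ 1 := by
      intro h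
      rw [h, mem_sphere, dist_eq_norm] at hw
      have := abs_re_le_norm (1 - ξ)
      rw [hw, sub_re, one_re] at this
      rw [abs_le] at this
      linarith [this.1]
    exact (differentiableAt_riemannZeta hw1).continuousAt.continuousWithinAt
  obtain ⟨w₀, hw₀, hmin⟩ := (isCompact_sphere ξ δ).exists_isMinOn
    (NormedSpace.sphere_nonempty.2 hδpos.le) hcont
  set ε : ℝ := ‖riemannZeta w₀‖ with hεdef
  have hεpos : 0 < ε := by
    rw [hεdef, norm_pos_iff]
    refine hpunct w₀ ?_ ?_
    · rw [mem_sphere.1 hw₀]; exact hδ₁'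
    · intro h
      have := mem_sphere.1 hw₀
      rw [h, dist_self] at this
      exact hδpos.ne this
  have hεle : ∀ w ∈ sphere ξ δ, ε ≤ ‖riemannZeta w‖ := fun w hw ↦ hmin hw
  -- Step 5: a LATE returning shift (weak recurrence) and the zero it generates (Rouché)
  obtain ⟨τ, hτT, hτ⟩ := hW ξ δ hδpos hδm ε hεpos (M + δ + 1 - ξ.im)
  obtain ⟨ρ, hρ0, hρdist⟩ := exists_zero_near_shift hξ0 hδpos (by linarith) hεle hτ
  -- Step 6: `ρ` is `≥ ε₀` off the line and has height `> M`: contradiction with Step 1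
  rw [dist_eq_norm] at hρdist
  have hre : |ρ.re - ξ.re| < δ := by
    have h := abs_re_le_norm (ρ - (ξ + τ * I))
    have h' : (ρ - (ξ + τ * I)).re = ρ.re - ξ.re := by
      simp only [sub_re, add_re, mul_re, ofReal_re, ofReal_im, I_re, I_im]; ring
    rw [h'] at h
    exact h.trans_lt hρdist
  have him : |ρ.im - (ξ.im + τ)| < δ := by
    have h := abs_im_le_norm (ρ - (ξ + τ * I))
    have h' : (ρ - (ξ + τ * I)).im = ρ.im - (ξ.im + τ) := by
      simp only [sub_im, add_im, mul_im, ofReal_re, ofReal_im, I_re, I_im]; ring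
    rw [h'] at h
    exact h.trans_lt hρdist
  rw [abs_lt] at hre him
  have hρmem : ρ ∈ {s : ℂ | riemannZeta s = 0 ∧ 0 < s.re ∧ s.re < 1 ∧ ε₀ ≤ |s.re - 1 / 2|} := by
    refine ⟨hρ0, by linarith, by linarith, ?_⟩
    rw [abs_of_pos (by linarith)]
    linarith
  have hle : ρ.im ≤ M := hM (Set.mem_image_of_mem Complex.im hρmem)
  linarith

/-- D2 is LOSSLESS: `X ⟺ #4 ∧ WR` (so refuting either piece refutes RH; neither piece alone is
known to be RH-equivalent). [cite: Steuding2007, Thm. 8.3] -/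
theorem exactFirstBand_iff_acl_and_weakRecurrence :
    ExactFirstBand ↔ AsymptoticCriticalLine ∧ ZetaWeakRecurrence := by
  refine ⟨fun hX ↦ ⟨?_, zetaWeakRecurrence_of_exactFirstBand hX⟩,
    fun h ↦ exactFirstBand_of_acl_of_weakRecurrence h.1 h.2⟩
  have hL := Summit.RiemannHypothesis.RiemannHypothesis.Theorems.ruelleBand_ladderGlue_proof
  exact hL.2 (hL.1 hX)

/-- The same split read at the summit. [cite: Steuding2007, Thm. 8.3] -/
theorem riemannHypothesis_iff_acl_and_weakRecurrence :
    RiemannHypothesis ↔ AsymptoticCriticalLine ∧ ZetaWeakRecurrence :=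
  Summit.RiemannHypothesis.Cruxes.ExactFirstBand.Negative.exactFirstBand_iff_riemannHypothesis.symm.trans
    exactFirstBand_iff_acl_and_weakRecurrence

end Summit.RiemannHypothesis.RiemannHypothesis.Cruxes.ExactFirstBand.Strategist

end
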